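import Summits.QuantumFields.YangMills.Theorems.UnitScaleTiltHalvingHSiteTorusBlocks
import Summits.QuantumFields.YangMills.Theorems.UnitScaleTiltHalvingCombTubeDictionary
import Literature.MathematicalPhysics.QuantumFieldTheory.Balaban1983to89.AveragingRT
import HarnessLib

/-!
# Line H (`BirthV10.stub_halvingStep`, stmt-QuantumFields-19200) — (M2′) (b)-row, (B-al-4)₃ LABELS: the level-`j` label boxes of the top cube, the pyramid of
# covered sites over them, the no-wrap left inverse of the level cover on each box, and the closure of the pyramid under «block centre ↦ centre-stair ends»

Cell `ym3-torus` (HUMAN RULING D-0037: YM₃ on T³ is ladder rung R3 — NOT d = 4, NOT infinite volume, NOT a mass gap, NOT the Clay problem), width seat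
`ym-ust-20520-w4` gen 11 (fallback pen of (B-al-4)₃ after ★w3-20520 g9's ■ FINAL; his `HANDOFF-w3-20520-g9.md` (P1)–(P3), (P10): «may need a geometry helper file
`…EffGaugeRowGLabels.lean`»).  `--supports stmt-QuantumFields-19200 --as helper`; THEOREMS ONLY (0 `def`, 0 `sorry`); count-neutral; nothing here claims
(B-al-4)₃, the (b)-row, (M2′), the stub, the crux or the gap.

WHAT (generic `P : Params`; integer∕torus bookkeeping only).  The (B-al-4)₃ pyramid is `S j := {π_j w | w ∈ Q_j}` with the level-`j` LABEL BOX
`Q_j := [tlo L lo (k−j), thi L hi (k−j)]` (`lo = sqLo L a ρ′ k k = a − ρ′`, `hi = sqHi L a M′ ρ′ k k = a + M′ − 1 + ρ′`, the `L^{k−j}`-blow-up of the top label box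
`□_k^{(k)} = cubeLamS L a M′ ρ′ k k k`):
* §1 `inBox_blowup` — `w ∈ [tlo lo n, thi hi n] ⇒ L•w + r ∈ [tlo lo (n+1), thi hi (n+1)]` for every `r ∈ [0,L)ᵈ` (the blocks of a box of the coarser lattice tile the
  blown-up box); `emb_coverAt_eq_boxVec`, `walkEnd_emb_stairWord_coverAt` — the block centre `emb (π_{j+1} w)` and the centre-stair ends `x_i` of (0.3) are the level-`j`
  covers `π_j (L•w + r)` (`r = (L−1)∕2·𝟙`, resp. `r = i.1`), so the pyramid is closed under the step of ✓`HalvingEffGaugeTowerRatioLocal.norm_effGauge_ratio_le_of_pyramid_local`.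
* §2 `eq_of_coverAt_eq_of_inBox` — `π_j` is injective on any box narrower than the period; `exists_leftInverse_coverAt` — hence a left inverse `lab : T^{(j)} → ℤᵈ` of `π_j`
  on the box exists (the reference family `A_j := (uavg L 1 u₁ j ∘ lab_j)⁻¹` of (B-al-4)₃ is then well defined on the pyramid); `width_lt_sitesPerDir_of_room` — the no-wrap
  room `2·(Lᵏ(M′+1) + ρ′·gs L k) ≤ |T_η|` of the (b)-row binder makes every `Q_j` narrower than the period of `T^{(j)}`.
* §3 the two ends: `inBox_top_iff_mem_cubeLamS` (`Q_k = □_k^{(k)}`), `inBox_valLift_iterBlockOf` (the label of `Bᵏx₀` lies in `Q_k`, from the corner row `ha`),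
  `inBox_zero_iff_mem_cube` (`Q_0 = □_k` on `T_η`) and `lift_add_rel_cover_eq_of_inBox_zero` (the (b)-row's window representative `lift x₀ + rel x₀ ·` IS the left
  inverse of `π` on `Q_0`, ✓`P1FlatCoreTopTargetRep.rep_cover_eq_of_mem_cube`).
* §4 `eml_idx_fst` — `exp[mean log]` over the stair index `Idx P = [0,L)ᵈ × S_d × S_d` of a family read through the block position only is `exp[mean log]` over `[0,L)ᵈ`
  (the two orderings are dummies), the dictionary between the torus frames `vframeU` and lit's corner-based site average (78) `savg`.
HONEST SCOPE.  Bookkeeping; no analysis.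

References: T. Bałaban, CMP **109** (1987) 249–301 [Balaban1987RG1] ((0.1)–(0.4) pp.251–253); CMP **99** (1985) 75–102 [Balaban1985RegularSpaces] (p.98, (1.131) p.99);
CMP **98** (1985) 17–51 [Balaban1985Averaging] ((78) p.30).
-/

set_option autoImplicit false

noncomputable section

open scoped BigOperators

namespace Summit.QuantumFields.YangMills.Theorems.HalvingEffGaugeRowGLabels

open Literature.MathematicalPhysics.QuantumFieldTheory.Balaban1983to89
open T4Continuum (walkEnd stairWord)
open BlockAveraging (Idx off)
open B14DomainGeom (Pt)
open Node00 (coverAt coverAt_apply coverAt_zero coverAt_eq_coverAt_iff coverAt_valLift emb_coverAt)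
open B7Prop1Explicit (boxVec)
open B7Prop1Local (InBox)
open B8Ineq130 (tlo thi tlo_apply thi_apply tlo_zero thi_zero)
open B8Eq131Cubes (cube sqLo sqHi bLo bHi gs cube_anti)
open B8CubeMemberZd (cubeLamS cubeLamS_self)
open B5Eq118OneStroke (iterBlockOf)
open B5Eq117TorusCarriers (sitesPerDir_zero_eq)
open B10Eq27TorusAxialLog (rel)
open B15Eq112TorusCover (cover lift cover_lift)
open ExpMeanLog (eml eml_eq_exp)
open Summit.QuantumFields.YangMills.Theorems.P1FlatCoreTopTargetRep (rep_cover_eq_of_mem_cube)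
open Summit.QuantumFields.YangMills.Theorems.HalvingCombTubeDictionary (blockSite_coverAt)
open BlockAveragingEMLLinearised (walkEnd_emb_stairWord_eq_blockSite)

variable {P : Params}

/-! ## §1 Blow-up of label boxes; the block centre and the centre-stair ends under the level cover -/

/-- **THE BLOCKS OF A COARSE BOX TILE THE BLOWN-UP BOX**: `w ∈ [tlo L lo n, thi L hi n] ⇒ L•w + r ∈ [tlo L lo (n+1), thi L hi (n+1)]` for `r ∈ [0,L)ᵈ`
(`tlo (n+1) = L·tlo n`, `thi (n+1) = L·(thi n + 1) − 1`). [cite: Balaban1985RegularSpaces, p.98 («for every j the cube □_j is a sum of the big blocks»)] -/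
theorem inBox_blowup {d L : ℕ} {lo hi : B7Prop1Explicit.Site d} {n : ℕ} {w : B7Prop1Explicit.Site d}
    (hw : InBox (tlo L lo n) (thi L hi n) w) (r : Fin d → Fin L) :
    InBox (tlo L lo (n + 1)) (thi L hi (n + 1)) ((L : ℤ) • w + boxVec L r) := by
  intro i
  obtain ⟨h1, h2⟩ := hw i
  have hr0 : (0 : ℤ) ≤ ((r i : ℕ) : ℤ) := Int.natCast_nonneg _
  have hrL : ((r i : ℕ) : ℤ) + 1 ≤ (L : ℤ) := by have := (r i).isLt; omega
  have hL0 : (0 : ℤ) ≤ (L : ℤ) := Int.natCast_nonneg _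
  simp only [B8Ineq130.tlo_succ_apply, B8Ineq130.thi_succ_apply, Pi.add_apply, Pi.smul_apply, smul_eq_mul, boxVec]
  constructor
  · nlinarith
  · nlinarith

/-- **THE BLOCK CENTRE IS THE COVER OF THE CORNER LABEL PLUS THE CENTRE OFFSET**: `emb (π_{j+1} w) = π_j (L•w + (L−1)∕2·𝟙)` with the offset written as the box
vector of the constant position `(L−1)∕2 ∈ [0,L)` (lit ✓`AveragingRT.half_lt`; standing range `j + 1 ≤ m + K`). [cite: Balaban1987RG1, (0.1) p.251] -/
theorem emb_coverAt_eq_boxVec {j : ℕ} (hj : j + 1 ≤ P.m + P.K) (w : Pt P.d) :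
    emb (coverAt P (j + 1) w) = coverAt P j ((P.L : ℤ) • w + boxVec P.L (fun _ => ⟨(P.L - 1) / 2, AveragingRT.half_lt P⟩)) := by
  rw [emb_coverAt hj]
  congr 1

/-- **THE CENTRE-STAIR ENDS ARE THE COVERS OF THE CORNER LABEL PLUS THE BLOCK POSITION**: `walkEnd (emb (π_{j+1} w)) Γ^σ(n(r)) = π_j (L•w + r)`
(✓`walkEnd_emb_stairWord_eq_blockSite` ∘ ✓`blockSite_coverAt`). [cite: Balaban1987RG1, (0.3) p.252, (0.1) p.251] -/
theorem walkEnd_emb_stairWord_coverAt {j : ℕ} (hj : j + 1 ≤ P.m + P.K) (w : Pt P.d) (i : Idx P) :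
    walkEnd (emb (coverAt P (j + 1) w)) (stairWord i.2.1 (off i.1)) = coverAt P j ((P.L : ℤ) • w + boxVec P.L i.1) := by
  rw [walkEnd_emb_stairWord_eq_blockSite, blockSite_coverAt hj]

/-! ## §2 The level cover is injective on a box narrower than the period; the left inverse; the room -/

/-- **NO WRAP**: two labels of a box narrower than the period of `T^{(j)}` with the same cover are equal (`π_j w = π_j w′ ⇔ |T^{(j)}| ∣ w′ − w` coordinatewise).
[cite: Balaban1987RG1, (0.1) p.251] -/
theorem eq_of_coverAt_eq_of_inBox {j : ℕ} {lo hi : Pt P.d} (hroom : ∀ μ, hi μ - lo μ < (P.sitesPerDir j : ℤ))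
    {w w' : Pt P.d} (hw : InBox lo hi w) (hw' : InBox lo hi w') (h : coverAt P j w = coverAt P j w') : w = w' := by
  rw [coverAt_eq_coverAt_iff] at h
  funext μ
  obtain ⟨c, hc⟩ := h μ
  obtain ⟨h1, h2⟩ := hw μ
  obtain ⟨h3, h4⟩ := hw' μ
  have hN := hroom μ
  have hN0 : (0 : ℤ) < (P.sitesPerDir j : ℤ) := by linarith
  -- `|w′ − w| < N` and `N ∣ w′ − w` force `c = 0`
  have hc0 : c = 0 := by
    rcases lt_trichotomy c 0 with hneg | hzero | hpos
    · exfalso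
      have : (P.sitesPerDir j : ℤ) * c ≤ (P.sitesPerDir j : ℤ) * (-1) := by nlinarith
      nlinarith
    · exact hzero
    · exfalso
      have : (P.sitesPerDir j : ℤ) * 1 ≤ (P.sitesPerDir j : ℤ) * c := by nlinarith
      nlinarith
  rw [hc0, mul_zero, sub_eq_zero] at hc
  exact hc.symm

/-- ★ **A LEFT INVERSE OF THE LEVEL COVER ON A BOX NARROWER THAN THE PERIOD**: there is `lab : T^{(j)} → ℤᵈ` with `lab (π_j w) = w` for every label `w` of the box
(choice of a preimage in the box + `eq_of_coverAt_eq_of_inBox`). [cite: Balaban1987RG1, (0.1) p.251] -/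
theorem exists_leftInverse_coverAt {j : ℕ} {lo hi : Pt P.d} (hroom : ∀ μ, hi μ - lo μ < (P.sitesPerDir j : ℤ)) :
    ∃ lab : Site P j → Pt P.d, ∀ w, InBox lo hi w → lab (coverAt P j w) = w := by
  classical
  refine ⟨fun x => if h : ∃ w, InBox lo hi w ∧ coverAt P j w = x then h.choose else 0, fun w hw => ?_⟩
  have hex : ∃ w', InBox lo hi w' ∧ coverAt P j w' = coverAt P j w := ⟨w, hw, rfl⟩
  dsimp only
  rw [dif_pos hex]
  exact eq_of_coverAt_eq_of_inBox hroom hex.choose_spec.1 hw hex.choose_spec.2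

/-- `sqLo L a ρ k k = a − ρ·𝟙` and `sqHi L a M ρ k k = a + (M − 1 + ρ)·𝟙` coordinatewise (depth `0`, `gs L 0 = 1`). [folklore] -/
theorem sqLo_top_apply (L : ℕ) {d : ℕ} (a : B7Prop1Explicit.Site d) (ρ k : ℕ) (i : Fin d) : sqLo L a ρ k k i = a i - ρ := by
  simp [sqLo, bLo]

/-- Companion of `sqLo_top_apply`. [folklore] -/
theorem sqHi_top_apply (L : ℕ) {d : ℕ} (a : B7Prop1Explicit.Site d) (M ρ k : ℕ) (i : Fin d) : sqHi L a M ρ k k i = a i + M - 1 + ρ := by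
  simp [sqHi, bHi]

/-- ★ **THE (b)-ROW's ROOM MAKES EVERY LEVEL-`j` LABEL BOX NARROWER THAN THE PERIOD OF `T^{(j)}`**: from `2·(Lᵏ·(M′+1) + ρ′·gs L k) ≤ |T_η|` (`|T_η| = Lʲ·|T^{(j)}|`,
`gs L k ≥ Lᵏ`): `thi L hi (k−j) − tlo L lo (k−j) = L^{k−j}·(M′ + 2ρ′) − 1 < |T^{(j)}|` for `lo = a − ρ′`, `hi = a + M′ − 1 + ρ′`. [cite: Balaban1984PropagatorsI, (1.18) p.20] -/
theorem width_lt_sitesPerDir_of_room {k j : ℕ} (hk : k ≤ P.m + P.K) (hjk : j ≤ k) (a : Pt P.d) {M' ρ' : ℕ}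
    (hroom : 2 * (P.L ^ k * (M' + 1) + ρ' * gs P.L k) ≤ P.sitesPerDir 0) (μ : Fin P.d) :
    thi P.L (sqHi P.L a M' ρ' k k) (k - j) μ - tlo P.L (sqLo P.L a ρ' k k) (k - j) μ < (P.sitesPerDir j : ℤ) := by
  have hg : P.L ^ k ≤ gs P.L k :=
    Finset.single_le_sum (f := fun i => P.L ^ i) (fun _ _ => Nat.zero_le _) (Finset.self_mem_range_succ k)
  -- in `ℕ`: `Lʲ · (L^{k−j}(M′ + 2ρ′)) ≤ Lʲ · |T^{(j)}|`
  have hN : P.L ^ (k - j) * (M' + 2 * ρ') ≤ P.sitesPerDir j := by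
    refine Nat.le_of_mul_le_mul_left ?_ (pow_pos P.L_pos j)
    calc P.L ^ j * (P.L ^ (k - j) * (M' + 2 * ρ')) = P.L ^ k * M' + 2 * (ρ' * P.L ^ k) := by
          rw [← mul_assoc, ← pow_add, Nat.add_sub_cancel' hjk]; ring
      _ ≤ 2 * (P.L ^ k * (M' + 1) + ρ' * gs P.L k) := by nlinarith [Nat.zero_le (P.L ^ k), Nat.zero_le M']
      _ ≤ P.sitesPerDir 0 := hroom
      _ = P.L ^ j * P.sitesPerDir j := sitesPerDir_zero_eq (P := P) (hjk.trans hk)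
  have hNz : ((P.L : ℤ)) ^ (k - j) * ((M' : ℤ) + 2 * ρ') ≤ (P.sitesPerDir j : ℤ) := by exact_mod_cast hN
  rw [thi_apply, tlo_apply, sqHi_top_apply, sqLo_top_apply]
  nlinarith

/-! ## §3 The two ends of the pyramid: the top label box is `□_k^{(k)}` and holds the label of `Bᵏx₀`; the bottom box is `□_k ⊂ T_η` and `lift x₀ + rel x₀ ·` inverts `π` on it -/

/-- **`Q_k = □_k^{(k)}`**: at depth `0` the label box is lit's `cubeLamS L a M′ ρ′ k k k` (✓`cubeLamS_self`). [cite: Balaban1985RegularSpaces, (1.131) p.99] -/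
theorem inBox_top_iff_mem_cubeLamS {d : ℕ} (L : ℕ) (a : B7Prop1Explicit.Site d) (M' ρ' k : ℕ) (yc : B7Prop1Explicit.Site d) :
    InBox (tlo L (sqLo L a ρ' k k) 0) (thi L (sqHi L a M' ρ' k k) 0) yc ↔ yc ∈ cubeLamS L a M' ρ' k k k := by
  rw [cubeLamS_self, tlo_zero, thi_zero]
  rfl

/-- **THE LABEL OF `Bᵏx₀` LIES IN THE TOP BOX**: from the corner row `a ≤ (Bᵏx₀)_ν ≤ a + M′ − 1` of the (b)-row binder, the label vector of `y₀ = Bᵏx₀` lies in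
`[a − ρ′, a + M′ − 1 + ρ′]` (and covers to `y₀` by ✓`coverAt_valLift`). [cite: Balaban1985RegularSpaces, p.98] -/
theorem inBox_valLift_iterBlockOf {k : ℕ} (x₀ : Site P 0) {a : Pt P.d} {M' ρ' : ℕ}
    (ha : ∀ ν, a ν ≤ ((iterBlockOf k x₀ ν).val : ℤ) ∧ ((iterBlockOf k x₀ ν).val : ℤ) ≤ a ν + M' - 1) :
    InBox (tlo P.L (sqLo P.L a ρ' k k) 0) (thi P.L (sqHi P.L a M' ρ' k k) 0) (fun μ => ((iterBlockOf k x₀ μ).val : ℤ)) := by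
  intro i
  obtain ⟨h1, h2⟩ := ha i
  rw [tlo_zero, thi_zero, sqLo_top_apply, sqHi_top_apply]
  have hρ : (0 : ℤ) ≤ (ρ' : ℤ) := Int.natCast_nonneg _
  constructor <;> linarith

/-- **`Q_0 = □_k` ON THE FINE LATTICE**: at depth `k` the label box is lit's cube `cube L a M′ ρ′ k k` (by definition). [cite: Balaban1985RegularSpaces, p.98] -/
theorem inBox_zero_iff_mem_cube {d : ℕ} (L : ℕ) (a : B7Prop1Explicit.Site d) (M' ρ' k : ℕ) (z : B7Prop1Explicit.Site d) :
    InBox (tlo L (sqLo L a ρ' k k) k) (thi L (sqHi L a M' ρ' k k) k) z ↔ z ∈ cube L a M' ρ' k k := Iff.rfl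

/-- ★ **THE WINDOW REPRESENTATIVE INVERTS THE COVER ON `Q_0`**: for `z ∈ Q_0 = □_k` (`⊂ □_0`, ✓`cube_anti`), `lift x₀ + rel x₀ (π z) = z`
(✓`rep_cover_eq_of_mem_cube` under the corner row `ha` and the room) — so the effective gauge's bottom `κ_0 = (u₁ ∘ (lift x₀ + rel x₀ ·))⁻¹` IS the reference
`(u₁ ∘ lab_0)⁻¹` on the pyramid's base. [cite: Balaban1985RegularSpaces, p.98, (1.131) p.99; Balaban1987RG1, (0.1) p.251] -/
theorem lift_add_rel_cover_eq_of_inBox_zero {k : ℕ} (hk : k ≤ P.m + P.K) (x₀ : Site P 0) {a : Pt P.d} {M' ρ' : ℕ}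
    (ha : ∀ ν, a ν ≤ ((iterBlockOf k x₀ ν).val : ℤ) ∧ ((iterBlockOf k x₀ ν).val : ℤ) ≤ a ν + M' - 1)
    (hroom : 2 * (P.L ^ k * (M' + 1) + ρ' * gs P.L k) ≤ P.sitesPerDir 0)
    {z : Pt P.d} (hz : InBox (tlo P.L (sqLo P.L a ρ' k k) k) (thi P.L (sqHi P.L a M' ρ' k k) k) z) :
    lift P x₀ + rel x₀ (cover P z) = z :=
  rep_cover_eq_of_mem_cube hk x₀ ha hroom (cube_anti (Nat.zero_le k) le_rfl ((inBox_zero_iff_mem_cube P.L a M' ρ' k z).1 hz))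

/-- `π_0 = π`: the level-`0` cover of a label is r15's cover (✓`coverAt_zero`), pointwise form. [cite: Balaban1987RG1, (0.1) p.251] -/
theorem coverAt_zero_apply (z : Pt P.d) : coverAt P 0 z = cover P z := by
  rw [coverAt_zero]

/-! ## §4 `exp[mean log]` over the stair index of a family read through the block position -/

/-- ★ **THE TWO ORDERINGS ARE DUMMIES**: for a family `F` on the block positions `[0,L)ᵈ`, `eml (fun i : Idx P => F i.1) = eml F` — the mean over
`Idx P = [0,L)ᵈ × S_d × S_d` of a function of the first factor is the mean over `[0,L)ᵈ`. [cite: Balaban1987RG1, (0.4) p.253 (uniform weights)] -/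
theorem eml_idx_fst {𝔸 : Type*} [NormedRing 𝔸] [NormedAlgebra ℂ 𝔸] [CompleteSpace 𝔸] (F : (Fin P.d → Fin P.L) → 𝔸) :
    eml (fun i : Idx P => F i.1) = eml F := by
  rw [eml_eq_exp, eml_eq_exp]
  congr 1
  have hsum : ∑ i : Idx P, MatrixLog.mlog (F i.1) =
      (Fintype.card (Equiv.Perm (Fin P.d) × Equiv.Perm (Fin P.d)) : ℂ) • ∑ r : Fin P.d → Fin P.L, MatrixLog.mlog (F r) := by
    rw [Fintype.sum_prod_type, Finset.smul_sum]
    refine Finset.sum_congr rfl fun r _ => ?_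
    simp only [Finset.sum_const, Finset.card_univ]
    rw [Nat.cast_smul_eq_nsmul]
  have hcard : (Fintype.card (Idx P) : ℂ) = (Fintype.card (Fin P.d → Fin P.L) : ℂ) * (Fintype.card (Equiv.Perm (Fin P.d) × Equiv.Perm (Fin P.d)) : ℂ) := by
    rw [← Nat.cast_mul, ← Fintype.card_prod]
  have hne : (Fintype.card (Equiv.Perm (Fin P.d) × Equiv.Perm (Fin P.d)) : ℂ) ≠ 0 := Nat.cast_ne_zero.2 Fintype.card_ne_zero
  rw [hsum, hcard, smul_smul, mul_inv, mul_assoc, inv_mul_cancel₀ hne, mul_one]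

end Summit.QuantumFields.YangMills.Theorems.HalvingEffGaugeRowGLabels

end
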